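import Mathlib
import HarnessLib
import Summits.NavierStokesRegularity.NavierStokesRegularity.Theorems.TaylorModelRungThreeCertificateSoundBridge
import Summits.NavierStokesRegularity.NavierStokesRegularity.Theorems.TaylorModelRungThreeCertificateIntervalDMatrixBounds
import Summits.NavierStokesRegularity.NavierStokesRegularity.Theorems.TaylorModelRungThreeReadoutCoords

/-!
# Crux K1b-DR (stmt-NavierStokesRegularity-23954), line `taylor-model` — certificate SOUNDNESS, v3 FORMAT BRIDGE:
# REAL matrices in the checker's window coordinates as maps on shell states (CERT-CONTRACT-23954 v3.1 §2/§3)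

In the v3 (vector-step, frame-absorbed) format the frames `Cm`, the propagated point matrices, the inverse `Ci` (which
exists only by the Neumann test of `…CertificateFrameNeumann` and is never tabulated) and the one-step derivative
enclosures are REAL `n × n` matrices in the checker's arithmetic window coordinates `c = i·m + (k + Kb)`
(`CertTables.idx/wi/wk/wv` of `…CertificateFormat` / `…SoundBridge`). This file is the generic interpretation layer that
`FormatV.toCertData` / `toBoxes` and the `ChainVRadii` soundness use for ALL of them:

* `CertTables.linF T a` — a coordinate matrix `a : ℕ → ℕ → ℝ` as a map on shell states (window rows and columns, zero
  off the window; v1's `linR φ A` is the case `a r c = φ (mget A r c)`), `CertTables.vecF T v` — a coordinate vector as a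
  window-supported state; window values `wv_linF` (`= Σ_{c<n} a r c · wv y c`), `wv_vecF`, support, linearity
  (`isLinearMap_linF`), COMPOSITION `linF_linF` (matrix product with `Finset.range n` sums — the shape of the kernel's
  `memMat_mulII`), identity `linF_eq_self_of_id` (the shape of `exists_inv_of_checkInvFrame`'s conclusion),
  `linF_vecF`, `vecF_wv`;
* absolute-value transfer `abs_linF_le_absMulVecUp` (|(linF a ξ)_(i,k)| ≤ (|A|·R)_(idx i k) from `abs_sum_le_absMulVecUp`);
* the reindexing `sum_nW_eq_sum_range` between the SEMANTIC window enumeration `Fin (nW cd)` /`modeOf`/`shellOf` of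
  `…ReadoutCoords` (an abstract `Fintype.equivFin`, used by `TaylorModelV.IsFlowPackageV` (F7′)/(F8′)) and the checker's
  arithmetic coordinates — both are sums over the window set `Fin 4 × [-Kb, Ka]`.

Pure bookkeeping; generic over the exact scalar type `K` of the tables. MODEL-lattice rung TL-M3 only; nothing here is a
statement about the Navier–Stokes equations.
-/

-- the sub-problem namespace repeats the summit name by design (D-0017)
set_option linter.dupNamespace false

namespace Summit.NavierStokesRegularity.NavierStokesRegularity.Theorems.TaylorModelCert

open scoped BigOperators
open Literature.Analysis.FluidPDE.TaoCascade Literature.Analysis.FluidPDE.TaoCascade.TaylorChain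
open Summit.NavierStokesRegularity.NavierStokesRegularity.Theorems.TaylorModelReadout

namespace CertTables

section LinF

variable {K : Type} (T : CertTables K)

/-- A REAL matrix in window coordinates as a map on shell states (window rows, window columns; zero off the
window). [folklore] -/
noncomputable def linF (a : ℕ → ℕ → ℝ) (y : Fin 4 → ℤ → ℝ) : Fin 4 → ℤ → ℝ := fun i k =>
  if -T.Kb ≤ k ∧ k ≤ T.Ka then
    ∑ i' : Fin 4, ∑ kk ∈ Finset.range T.m, a (T.idx i k) (i'.val * T.m + kk) * y i' ((kk : ℤ) - T.Kb)
  else 0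

/-- A REAL vector in window coordinates as a shell state (zero off the window). [folklore] -/
noncomputable def vecF (v : ℕ → ℝ) : Fin 4 → ℤ → ℝ := fun i k => if -T.Kb ≤ k ∧ k ≤ T.Ka then v (T.idx i k) else 0

/-- `linF` on the window as a coordinate sum. [folklore] -/
theorem linF_apply_of_InW (a : ℕ → ℕ → ℝ) (y : Fin 4 → ℤ → ℝ) (i : Fin 4) {k : ℤ} (hk : -T.Kb ≤ k ∧ k ≤ T.Ka) :
    T.linF a y i k = ∑ c ∈ Finset.range T.n, a (T.idx i k) c * T.wv y c := by
  unfold linF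
  rw [if_pos hk]
  exact T.sum_window_wv (fun c => a (T.idx i k) c) y

/-- `linF` vanishes off the window. [folklore] -/
theorem linF_off (a : ℕ → ℕ → ℝ) (y : Fin 4 → ℤ → ℝ) (i : Fin 4) {k : ℤ} (hk : ¬ (-T.Kb ≤ k ∧ k ≤ T.Ka)) :
    T.linF a y i k = 0 := by
  unfold linF; rw [if_neg hk]

/-- Window values of `linF`. [folklore] -/
theorem wv_linF (a : ℕ → ℕ → ℝ) (y : Fin 4 → ℤ → ℝ) {r : ℕ} (hr : r < T.n) :
    T.wv (T.linF a y) r = ∑ c ∈ Finset.range T.n, a r c * T.wv y c := by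
  have h := T.linF_apply_of_InW a y (T.wi r) (T.InW_wk hr)
  rw [T.idx_wi_wk hr] at h
  simpa only [wv] using h

/-- `vecF` on and off the window. [folklore] -/
theorem vecF_apply (v : ℕ → ℝ) (i : Fin 4) (k : ℤ) :
    T.vecF v i k = if -T.Kb ≤ k ∧ k ≤ T.Ka then v (T.idx i k) else 0 := rfl

/-- Window values of `vecF`. [folklore] -/
theorem wv_vecF (v : ℕ → ℝ) {c : ℕ} (hc : c < T.n) : T.wv (T.vecF v) c = v c := by
  unfold wv
  rw [vecF_apply, if_pos (T.InW_wk hc), T.idx_wi_wk hc]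

/-- `vecF` vanishes off the window. [folklore] -/
theorem vecF_off (v : ℕ → ℝ) (i : Fin 4) {k : ℤ} (hk : ¬ (-T.Kb ≤ k ∧ k ≤ T.Ka)) : T.vecF v i k = 0 := by
  rw [vecF_apply, if_neg hk]

/-- `linF a` is `ℝ`-linear. [folklore] -/
theorem isLinearMap_linF (a : ℕ → ℕ → ℝ) : IsLinearMap ℝ (T.linF a) := by
  constructor
  · intro y y'
    funext i k
    by_cases hk : -T.Kb ≤ k ∧ k ≤ T.Ka
    · simp only [Pi.add_apply, T.linF_apply_of_InW a _ i hk, wv, mul_add, Finset.sum_add_distrib]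
    · simp only [Pi.add_apply, T.linF_off a _ i hk, add_zero]
  · intro r y
    funext i k
    by_cases hk : -T.Kb ≤ k ∧ k ≤ T.Ka
    · simp only [Pi.smul_apply, smul_eq_mul, T.linF_apply_of_InW a _ i hk, wv, Finset.mul_sum]
      exact Finset.sum_congr rfl fun c _ => by ring
    · simp only [Pi.smul_apply, smul_eq_mul, T.linF_off a _ i hk, mul_zero]

/-- `linF` only depends on the `n × n` block of the matrix. [folklore] -/
theorem linF_congr {a b : ℕ → ℕ → ℝ} (h : ∀ r < T.n, ∀ c < T.n, a r c = b r c) (y : Fin 4 → ℤ → ℝ) :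
    T.linF a y = T.linF b y := by
  funext i k
  by_cases hk : -T.Kb ≤ k ∧ k ≤ T.Ka
  · rw [T.linF_apply_of_InW a y i hk, T.linF_apply_of_InW b y i hk]
    exact Finset.sum_congr rfl fun c hc => by rw [h _ (T.idx_lt_n i hk) c (Finset.mem_range.1 hc)]
  · rw [T.linF_off a y i hk, T.linF_off b y i hk]

/-- **Composition = matrix product** (range sums, the shape of `memMat_mulII`). [folklore] -/
theorem linF_linF (a b : ℕ → ℕ → ℝ) (y : Fin 4 → ℤ → ℝ) :
    T.linF a (T.linF b y) = T.linF (fun r c => ∑ t ∈ Finset.range T.n, a r t * b t c) y := by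
  funext i k
  by_cases hk : -T.Kb ≤ k ∧ k ≤ T.Ka
  · rw [T.linF_apply_of_InW a _ i hk, T.linF_apply_of_InW _ y i hk]
    have e : ∀ c ∈ Finset.range T.n, a (T.idx i k) c * T.wv (T.linF b y) c =
        ∑ t ∈ Finset.range T.n, a (T.idx i k) c * b c t * T.wv y t := fun c hc => by
      rw [T.wv_linF b y (Finset.mem_range.1 hc), Finset.mul_sum]
      exact Finset.sum_congr rfl fun t _ => by ring
    rw [Finset.sum_congr rfl e, Finset.sum_comm]
    exact Finset.sum_congr rfl fun t _ => by rw [Finset.sum_mul]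
  · rw [T.linF_off a _ i hk, T.linF_off _ y i hk]

/-- **Identity**: a matrix equal to `1` on `n × n` acts as the identity on window-supported states. [folklore] -/
theorem linF_eq_self_of_id {a : ℕ → ℕ → ℝ} (hid : ∀ r < T.n, ∀ c < T.n, a r c = if r = c then 1 else 0)
    {y : Fin 4 → ℤ → ℝ} (hy : ∀ i k, ¬ (-T.Kb ≤ k ∧ k ≤ T.Ka) → y i k = 0) : T.linF a y = y := by
  funext i k
  by_cases hk : -T.Kb ≤ k ∧ k ≤ T.Ka
  · rw [T.linF_apply_of_InW a y i hk]
    have hr := T.idx_lt_n i hk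
    rw [Finset.sum_congr rfl fun c hc => by rw [hid _ hr c (Finset.mem_range.1 hc)]]
    simp only [ite_mul, one_mul, zero_mul, Finset.sum_ite_eq, Finset.mem_range, if_pos hr]
    exact T.wv_idx y i hk
  · rw [T.linF_off a y i hk, hy i k hk]

/-- `linF a (vecF v) = vecF (a·v)`. [folklore] -/
theorem linF_vecF (a : ℕ → ℕ → ℝ) (v : ℕ → ℝ) :
    T.linF a (T.vecF v) = T.vecF fun r => ∑ c ∈ Finset.range T.n, a r c * v c := by
  funext i k
  by_cases hk : -T.Kb ≤ k ∧ k ≤ T.Ka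
  · rw [T.linF_apply_of_InW a _ i hk, vecF_apply, if_pos hk]
    exact Finset.sum_congr rfl fun c hc => by rw [T.wv_vecF v (Finset.mem_range.1 hc)]
  · rw [T.linF_off a _ i hk, T.vecF_off _ i hk]

/-- A window-supported state is `vecF` of its window values. [folklore] -/
theorem vecF_wv {y : Fin 4 → ℤ → ℝ} (hy : ∀ i k, ¬ (-T.Kb ≤ k ∧ k ≤ T.Ka) → y i k = 0) : T.vecF (T.wv y) = y := by
  funext i k
  by_cases hk : -T.Kb ≤ k ∧ k ≤ T.Ka
  · rw [vecF_apply, if_pos hk, T.wv_idx y i hk]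
  · rw [T.vecF_off _ i hk, hy i k hk]

/-- **Absolute-value transfer**: `|a| ≤ A`, `|wv ξ| ≤ R` entrywise ⇒ `|(linF a ξ)_(i,k)| ≤ (|A|·R)_(idx i k)` (the
kernel's `absMulVecUp`). [folklore] -/
theorem abs_linF_le_absMulVecUp (prec : ℕ) {a : ℕ → ℕ → ℝ} {A : Array (Array Dyad)} (ha : AbsLeMat T.n a A)
    {ξ : Fin 4 → ℤ → ℝ} {R : Array Dyad} (hξ : AbsLeVec T.n (T.wv ξ) R) (i : Fin 4) {k : ℤ}
    (hk : -T.Kb ≤ k ∧ k ≤ T.Ka) : |T.linF a ξ i k| ≤ vre (absMulVecUp T.n prec A R) (T.idx i k) := by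
  rw [T.linF_apply_of_InW a ξ i hk]
  exact abs_sum_le_absMulVecUp prec ha hξ (T.idx_lt_n i hk)

end LinF

/-! ### The semantic window enumeration versus the arithmetic coordinates -/

section Reindex

variable {K : Type} (T : CertTables K)

/-- The window shell sum as a sum over `kk < m`. [folklore] -/
theorem sum_Icc_eq_sum_range (f : ℤ → ℝ) :
    ∑ k ∈ Finset.Icc (-T.Kb) T.Ka, f k = ∑ kk ∈ Finset.range T.m, f ((kk : ℤ) - T.Kb) := by
  refine Finset.sum_bij' (fun k _ => (k + T.Kb).toNat) (fun kk _ => (kk : ℤ) - T.Kb) ?_ ?_ ?_ ?_ ?_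
  · intro k hk
    rw [Finset.mem_Icc] at hk
    rw [Finset.mem_range]
    unfold m; omega
  · intro kk hkk
    rw [Finset.mem_range] at hkk
    rw [Finset.mem_Icc]
    unfold m at hkk; omega
  · intro k hk
    rw [Finset.mem_Icc] at hk
    omega
  · intro kk hkk
    omega
  · intro k hk
    rw [Finset.mem_Icc] at hk
    congr 1; omega

/-- **Reindexing**: a sum over the semantic window coordinates `Fin (nW cd)` (`modeOf`, `shellOf`) equals the sum over
the checker's arithmetic coordinates `c < n` (`wi`, `wk`), for a record with the same window. [folklore] -/
theorem sum_nW_eq_sum_range (cd : CertData) (hKb : cd.Kb = T.Kb) (hKa : cd.Ka = T.Ka) (f : Fin 4 → ℤ → ℝ) :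
    ∑ c : Fin (nW cd), f (modeOf cd c) (shellOf cd c) = ∑ c ∈ Finset.range T.n, f (T.wi c) (T.wk c) := by
  -- left: sum over the window index set `Fin 4 × Icc`
  have h1 : ∑ c : Fin (nW cd), f (modeOf cd c) (shellOf cd c) = ∑ p : WinIdx cd, f p.1 (p.2 : ℤ) := by
    simp only [modeOf, shellOf]
    exact Equiv.sum_comp (eW cd).symm (fun p : WinIdx cd => f p.1 (p.2 : ℤ))
  rw [h1, Fintype.sum_prod_type]
  -- right: the double window sum
  rw [← T.sum_window (fun c => f (T.wi c) (T.wk c))]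
  refine Finset.sum_congr rfl fun i _ => ?_
  rw [Finset.sum_coe_sort (Finset.Icc (-cd.Kb) cd.Ka) (fun k : ℤ => f i k), hKb, hKa, T.sum_Icc_eq_sum_range]
  refine Finset.sum_congr rfl fun kk hkk => ?_
  rw [Finset.mem_range] at hkk
  rw [T.wi_of_pair i hkk, T.wk_of_pair i hkk]

end Reindex

end CertTables

end Summit.NavierStokesRegularity.NavierStokesRegularity.Theorems.TaylorModelCert
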